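import Mathlib
import HarnessLib
import Summits.HubbardSuperconductivity.HubbardSuperconductivity.Theorems.KLProgrammeKLRegimeEngineV8IsoMomentRow
import Summits.HubbardSuperconductivity.HubbardSuperconductivity.Theorems.KLProgrammeKLRegimeEngineV8DefsGeo9

/-!
# K3 ENGINE package, `G`-level v10 (PROPOSED; k3c2-p2 g14, cure «G10-MOM» of «(X).2-B-FIT-OPAQUE», KL STATUS 2026-08-28 ≈01:12Z):
# the CF-only door `GeoConsts.raiseCF`, the EXPLICIT class-#6 constants `klE5AM/klE5cM/klE5dM/klE5uM/klE5CFM` with THE FIT, and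
# `klEngGeo10 := klEngGeo9.raiseCF klE5CFM`

WHY.  See `…EngineV8IsoMomentRow`: the class-#6 iso line's U-linear constant `2¹⁷·klIsoMomC` is G-level opaque, so the freezing / (E5-F) constant `CF`
must carry it SYMBOLICALLY for the stub-(c) consumer's fit `A + 2(c + c′Klam²U) ≤ G.CF` to close; this file raises `CF` alone (every other field, in
particular `cE4`, the gains and the (E3) sizes, untouched) and proves the fit at any `CF ≥ klEngGeo8.CF + klE5CFM`, in particular at `klEngGeo10`.

CONTENTS.
* §3 **`GeoConsts.raiseCF G x := { G with CF := G.CF + x }`** — `rfl` field rows, `CF_le_raiseCF`, `raiseCF_wf` (`0 ≤ x`), the monotone lifts of the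
  CF-reading majorant/slot (`thermalBar_le_raiseCF`, `isoTupleL1AtV17F_raiseCF_of`) and `Iff.rfl` for slots that do not read `CF`.
* §4 the EXPLICIT class-#6 constants **`klE5AM := 2⁹`**, **`klE5cM := max (2¹⁷klIsoMomC) (klIsoT⁴/2)`**,
  **`klE5dM P R := max (2¹⁷klIsoMomD P R) (klIsoT⁴·klScaleZeroValC R/192)`**, the threshold **`klE5uM P R := 2⁶⁰/(Klam²·(klE5dM P R + 1))`** (`cc`-free
  DefsU entry), the CF supplement **`klE5CFM := 2¹⁸·klIsoMomC`**, sign/order rows, and **THE FIT `klE5M_fit`**: `klEngGeo8.CF + klE5CFM ≤ CF`, `U ≤ klE5uM P R`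
  ⟹ `klE5AM + 2(klE5cM + klE5dM P R·Klam²·U) ≤ CF` (room: `2⁸⁰ ≤ klEngGeo8.CF`, `2²⁸klIsoT⁴ ≤ klEngGeo8.CF`).
* §5 **`klEngGeo10 := klEngGeo9.raiseCF klE5CFM`** (+ `klEngGeo10_wf`, `rfl`/order rows, `klEngGeo8_CF_add_klE5CFM_le_klEngGeo10_CF`, `klE5M_fit_klEngGeo10`) —
  registrant token `klEngGeo9 ↦ klEngGeo10` IF the pen rules the cure in; otherwise an unused closed term.
Definitions with bodies + order lemmas + one inequality; nothing about the model is asserted; nothing asserts superconductivity.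
-/

noncomputable section

namespace Summit.HubbardSuperconductivity.HubbardSuperconductivity.Theorems.KLRegimeSplit

set_option linter.dupNamespace false -- summit = problem name (single-conjunct summit), D-0017

open Real Finset Literature.MathematicalPhysics.QuantumLattice Literature.Probability.LatticeModels
open Summit.HubbardSuperconductivity.HubbardSuperconductivity.Theorems.KLProgrammeLegKernels
open Summit.HubbardSuperconductivity.HubbardSuperconductivity.Theorems.DispersionFlow
open Summit.HubbardSuperconductivity.HubbardSuperconductivity.Theorems.EngineV8

/-! ## §3 `GeoConsts.raiseCF` — raising the freezing / (E5-F) constant alone -/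

/-- **`G.raiseCF x`** — the geometric package `G` with `CF := G.CF + x`, EVERY other field untouched. -/
def GeoConsts.raiseCF (G : GeoConsts) (x : ℝ) : GeoConsts :=
  { G with CF := G.CF + x }

namespace GeoConsts

variable (G : GeoConsts) (x : ℝ)

/-- `(G.raiseCF x).CF = G.CF + x`. -/
theorem raiseCF_CF : (G.raiseCF x).CF = G.CF + x := rfl
/-- untouched field `cE4`. -/
theorem raiseCF_cE4 : (G.raiseCF x).cE4 = G.cE4 := rfl
/-- untouched field `atop`. -/
theorem raiseCF_atop : (G.raiseCF x).atop = G.atop := rfl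
/-- untouched field `abot`. -/
theorem raiseCF_abot : (G.raiseCF x).abot = G.abot := rfl
/-- untouched field `blo`. -/
theorem raiseCF_blo : (G.raiseCF x).blo = G.blo := rfl
/-- untouched field `bhi`. -/
theorem raiseCF_bhi : (G.raiseCF x).bhi = G.bhi := rfl
/-- untouched field `cloc`. -/
theorem raiseCF_cloc : (G.raiseCF x).cloc = G.cloc := rfl
/-- untouched field `θ`. -/
theorem raiseCF_θ : (G.raiseCF x).θ = G.θ := rfl
/-- untouched field `a`. -/
theorem raiseCF_a : (G.raiseCF x).a = G.a := rfl
/-- untouched field `ζ`. -/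
theorem raiseCF_ζ : (G.raiseCF x).ζ = G.ζ := rfl
/-- untouched field `Z`. -/
theorem raiseCF_Z : (G.raiseCF x).Z = G.Z := rfl
/-- untouched field `aplus`. -/
theorem raiseCF_aplus : (G.raiseCF x).aplus = G.aplus := rfl
/-- untouched field `ppGain`. -/
theorem raiseCF_ppGain : (G.raiseCF x).ppGain = G.ppGain := rfl
/-- untouched field `phGain`. -/
theorem raiseCF_phGain : (G.raiseCF x).phGain = G.phGain := rfl
/-- untouched field `S`. -/
theorem raiseCF_S : (G.raiseCF x).S = G.S := rfl
/-- untouched field `Bf`. -/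
theorem raiseCF_Bf : (G.raiseCF x).Bf = G.Bf := rfl
/-- untouched field `SL`. -/
theorem raiseCF_SL : (G.raiseCF x).SL = G.SL := rfl

variable {G x}

/-- `G.CF ≤ (G.raiseCF x).CF` for `0 ≤ x`. -/
theorem CF_le_raiseCF (hx : 0 ≤ x) : G.CF ≤ (G.raiseCF x).CF := by
  rw [raiseCF_CF]; linarith

/-- **Raising `CF` preserves well-formedness** (`0 ≤ x`): `CF` enters `GeoConsts.WF` through `0 ≤ CF` and as the UPPER bound of the two gain sums. -/
theorem raiseCF_wf (hG : G.WF) (hx : 0 ≤ x) : (G.raiseCF x).WF := by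
  obtain ⟨h1, h2, h3, h4, h5, h6, h7, h8, h9, h10, h11, h12, h13, h14, h15, h16, h17, h18, h19, h20⟩ := hG
  refine ⟨h1, h2, h3, h4, h5, h6, h7, h8, h9, h10, h11, h12, h13, ?_, ?_, ?_, h17, h18, h19, h20⟩
  · show 0 ≤ G.CF + x
    linarith
  · intro ρ N hρ
    show ∑ n ∈ range N, G.phGain n ρ ≤ G.CF + x
    linarith [h15 ρ N hρ]
  · intro ρ t N hρ
    show ∑ n ∈ Ioc t N, G.ppGain n ρ ≤ G.CF + x
    linarith [h16 ρ t N hρ]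

end GeoConsts

/-! ### The CF-reading majorant and slots under `raiseCF` (monotone), the others `Iff.rfl` -/

section RaiseCFSlots

variable {L M : ℕ} [NeZero L] [NeZero M] {G : GeoConsts} {P : SplitConsts} {Q : EngConsts} {β U μ : ℝ} {K : TrigPolyC4v} {n : ℕ} (x : ℝ)

/-- `thermalBar` grows along `raiseCF` (`0 ≤ x`). -/
theorem thermalBar_le_raiseCF (hx : 0 ≤ x) (P : SplitConsts) (U β : ℝ) (n : ℕ) :
    thermalBar G P U β n ≤ thermalBar (G.raiseCF x) P U β n := by
  unfold thermalBar
  rw [GeoConsts.raiseCF_CF]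
  have : 0 ≤ (P.Klam * U) ^ 2 * ((4 : ℝ) ^ (nScales β - n))⁻¹ := by positivity
  nlinarith

/-- **(E5-F) lifts along `raiseCF`** (`0 ≤ x`, `0 ≤ U`; monotone in `CF`). -/
theorem isoTupleL1AtV17F_raiseCF_of (hx : 0 ≤ x) (h : IsoTupleL1AtV17F L M G P β U μ n) :
    IsoTupleL1AtV17F L M (G.raiseCF x) P β U μ n := by
  intro B hB hvals m hm Ω hΩ x₁
  refine (h B hB hvals m hm Ω hΩ x₁).trans ?_
  rw [GeoConsts.raiseCF_CF]
  have hK : 0 ≤ (P.Klam * U) ^ 2 := sq_nonneg _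
  nlinarith

/-- (E2′-F UV) does not read `CF`. -/
theorem quarticValueUVAtV17F_raiseCF_iff :
    QuarticValueUVAtV17F L M (G.raiseCF x) P Q β U μ n ↔ QuarticValueUVAtV17F L M G P Q β U μ n := Iff.rfl

/-- (E3a-F) reads only `G.S` (untouched). -/
theorem twoLegReadJetsF_raiseCF_iff :
    TwoLegReadJetsF L M (G.raiseCF x) Q β U μ n ↔ TwoLegReadJetsF L M G Q β U μ n := Iff.rfl

/-- The split slot does not read `G`. -/
theorem betaSplitAtV17F_raiseCF_iff :
    BetaSplitAtV17F L M (G.raiseCF x) P Q β U μ n ↔ BetaSplitAtV17F L M G P Q β U μ n := Iff.rfl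

/-- (E4) does not read `CF`. -/
theorem engineFirstMoments_raiseCF_iff :
    EngineFirstMoments L M (G.raiseCF x) P Q β U μ K n ↔ EngineFirstMoments L M G P Q β U μ K n := Iff.rfl

end RaiseCFSlots

/-! ## §4 The EXPLICIT class-#6 constants and THE FIT -/

section Explicit

/-- **`klE5AM := 2⁹`** — the class-#6 B-coefficient (route (M)'s `A`). -/
def klE5AM : ℝ := 2 ^ 9

/-- **`klE5cM := max (2¹⁷·klIsoMomC) (klIsoT⁴/2)`** — the class-#6 U-linear constant (route (M) at `n ≥ 1` ∨ the scale-0 line). -/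
def klE5cM : ℝ := max (2 ^ 17 * klIsoMomC) (klIsoT ^ 4 / 2)

/-- **`klE5dM P R := max (2¹⁷·klIsoMomD P R) (klIsoT⁴·klScaleZeroValC R/192)`** — the class-#6 quadratic constant. -/
def klE5dM (P : SplitConsts) (R : RenConsts) : ℝ := max (2 ^ 17 * klIsoMomD P R) (klIsoT ^ 4 * klScaleZeroValC R / 192)

/-- **`klE5uM P R := 2⁶⁰/(Klam²·(klE5dM P R + 1))`** — the class-#6 coupling threshold (a DefsU `min` entry; `cc`-free). -/
def klE5uM (P : SplitConsts) (R : RenConsts) : ℝ := 2 ^ 60 / (P.Klam ^ 2 * (klE5dM P R + 1))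

/-- **`klE5CFM := 2¹⁸·klIsoMomC`** — the class-#6 CF supplement (`klEngGeo10 := klEngGeo9.raiseCF klE5CFM`). -/
def klE5CFM : ℝ := 2 ^ 18 * klIsoMomC

/-- `klE5AM = 2⁹`. -/
theorem klE5AM_eq : klE5AM = 2 ^ 9 := rfl
/-- `0 ≤ klE5AM`. -/
theorem klE5AM_nonneg : 0 ≤ klE5AM := by unfold klE5AM; positivity
/-- `0 ≤ klE5cM`. -/
theorem klE5cM_nonneg : 0 ≤ klE5cM := by
  have := klIsoT_nonneg
  unfold klE5cM
  exact le_max_of_le_right (by positivity)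
/-- `2¹⁷·klIsoMomC ≤ klE5cM`. -/
theorem klE5cM_ge_mom : 2 ^ 17 * klIsoMomC ≤ klE5cM := le_max_left _ _
/-- `klIsoT⁴/2 ≤ klE5cM`. -/
theorem klE5cM_ge_zero_line : klIsoT ^ 4 / 2 ≤ klE5cM := le_max_right _ _
/-- `0 ≤ klE5dM P R` (`R.WF2`). -/
theorem klE5dM_nonneg (P : SplitConsts) {R : RenConsts} (hR : R.WF2) : 0 ≤ klE5dM P R := by
  have hV0 : 0 < klScaleZeroValC R := klScaleZeroValC_pos (gfr_nonneg_of_wf2 hR 0)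
  have := klIsoT_nonneg
  unfold klE5dM
  exact le_max_of_le_right (by positivity)
/-- `2¹⁷·klIsoMomD P R ≤ klE5dM P R`. -/
theorem klE5dM_ge_mom (P : SplitConsts) (R : RenConsts) : 2 ^ 17 * klIsoMomD P R ≤ klE5dM P R := le_max_left _ _
/-- `klIsoT⁴·klScaleZeroValC R/192 ≤ klE5dM P R`. -/
theorem klE5dM_ge_zero_line (P : SplitConsts) (R : RenConsts) : klIsoT ^ 4 * klScaleZeroValC R / 192 ≤ klE5dM P R := le_max_right _ _
/-- `0 < klE5uM P R` (`P.WF`, `R.WF2`). -/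
theorem klE5uM_pos {P : SplitConsts} {R : RenConsts} (hP : P.WF) (hR : R.WF2) : 0 < klE5uM P R := by
  have hK : 1 ≤ P.Klam := hP.1
  have hd := klE5dM_nonneg P hR
  unfold klE5uM
  positivity
/-- `0 ≤ klE5CFM`. -/
theorem klE5CFM_nonneg : 0 ≤ klE5CFM := by have := klIsoMomC_nonneg; unfold klE5CFM; positivity
/-- `klE5CFM = 2¹⁸·klIsoMomC`. -/
theorem klE5CFM_eq : klE5CFM = 2 ^ 18 * klIsoMomC := rfl

/-- **THE FIT of the explicit class-#6 line**: at any `CF` with `klEngGeo8.CF + klE5CFM ≤ CF` and below the threshold `U ≤ klE5uM P R` (`P.WF`,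
`R.WF2`), `klE5AM + 2·(klE5cM + klE5dM P R·Klam²·U) ≤ CF` — room: `2⁸⁰ ≤ klEngGeo8.CF`, `2²⁸·klIsoT⁴ ≤ klEngGeo8.CF`, `2¹⁸·klIsoMomC = klE5CFM`. -/
theorem klE5M_fit {P : SplitConsts} {R : RenConsts} (hP : P.WF) (hR : R.WF2) {CF U : ℝ} (hCF : klEngGeo8.CF + klE5CFM ≤ CF)
    (hU : U ≤ klE5uM P R) : klE5AM + 2 * (klE5cM + klE5dM P R * P.Klam ^ 2 * U) ≤ CF := by
  have hT4 : 0 ≤ klIsoT ^ 4 := pow_nonneg klIsoT_nonneg 4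
  have hC0 : 0 ≤ klIsoMomC := klIsoMomC_nonneg
  have hK1 : 1 ≤ P.Klam := hP.1
  have hK2 : 0 < P.Klam ^ 2 := by positivity
  have hd : 0 ≤ klE5dM P R := klE5dM_nonneg P hR
  have hCF80 := two_pow_eighty_le_klEngGeo8_CF
  have hCFT := two_pow_mul_klIsoT_pow_four_le_klEngGeo8_CF
  -- the U-linear maximum
  have hc : klE5cM ≤ 2 ^ 17 * klIsoMomC + klIsoT ^ 4 / 2 := by
    unfold klE5cM; exact max_le_add_of_nonneg (by positivity) (by positivity)
  -- the quadratic term against the threshold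
  have hq : klE5dM P R * P.Klam ^ 2 * U ≤ 2 ^ 60 := by
    have h1 : klE5dM P R * P.Klam ^ 2 * U ≤ klE5dM P R * P.Klam ^ 2 * (2 ^ 60 / (P.Klam ^ 2 * (klE5dM P R + 1))) :=
      mul_le_mul_of_nonneg_left hU (by positivity)
    have h2 : klE5dM P R * P.Klam ^ 2 * (2 ^ 60 / (P.Klam ^ 2 * (klE5dM P R + 1))) = 2 ^ 60 * (klE5dM P R / (klE5dM P R + 1)) := by
      field_simp
    have h3 : klE5dM P R / (klE5dM P R + 1) ≤ 1 := by
      rw [div_le_one (by positivity)]; linarith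
    calc klE5dM P R * P.Klam ^ 2 * U ≤ 2 ^ 60 * (klE5dM P R / (klE5dM P R + 1)) := h1.trans h2.le
      _ ≤ 2 ^ 60 * 1 := mul_le_mul_of_nonneg_left h3 (by positivity)
      _ = 2 ^ 60 := mul_one _
  have hA : klE5AM = 2 ^ 9 := rfl
  have hX : klE5CFM = 2 ^ 18 * klIsoMomC := rfl
  rw [hA]
  rw [hX] at hCF
  -- `2⁹ + 2·(2¹⁷C + T⁴/2 + 2⁶⁰) = 2⁹ + 2⁶¹ + T⁴ + 2¹⁸C ≤ (2⁸⁰ + 2²⁸T⁴)/2 + 2¹⁸C ≤ klEngGeo8.CF + 2¹⁸C ≤ CF`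
  nlinarith

end Explicit

end Summit.HubbardSuperconductivity.HubbardSuperconductivity.Theorems.KLRegimeSplit

namespace Summit.HubbardSuperconductivity.HubbardSuperconductivity.Theorems.EngineV8

set_option linter.dupNamespace false -- summit = problem name (single-conjunct summit), D-0017

open Real Finset Literature.MathematicalPhysics.QuantumLattice Literature.Probability.LatticeModels
open Summit.HubbardSuperconductivity.HubbardSuperconductivity.Theorems.KLRegimeSplit
open Summit.HubbardSuperconductivity.HubbardSuperconductivity.Theorems.KLProgrammeLegKernels
open Summit.HubbardSuperconductivity.HubbardSuperconductivity.Theorems.DispersionFlow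

/-! ## §5 The PROPOSED package token `klEngGeo10 := klEngGeo9.raiseCF klE5CFM` (used only if the cure is registered) -/

/-- **`klEngGeo10` — the engine-flow package's absolute constants `G`, v10 (PROPOSED)**: `klEngGeo9` with `CF := CF + 2¹⁸·klIsoMomC`, nothing else moved. -/
def klEngGeo10 : GeoConsts := klEngGeo9.raiseCF klE5CFM

/-- `klEngGeo10 = klEngGeo9.raiseCF klE5CFM` (`rfl`; the form the `_raiseCF` doors consume). -/
theorem klEngGeo10_eq : klEngGeo10 = klEngGeo9.raiseCF klE5CFM := rfl

/-- `klEngGeo10` is well formed. -/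
theorem klEngGeo10_wf : klEngGeo10.WF := GeoConsts.raiseCF_wf klEngGeo9_wf klE5CFM_nonneg

/-- `klEngGeo10.CF = klEngGeo9.CF + klE5CFM`. -/
theorem klEngGeo10_CF : klEngGeo10.CF = klEngGeo9.CF + klE5CFM := rfl

/-- `klEngGeo9.CF ≤ klEngGeo10.CF`. -/
theorem klEngGeo9_CF_le_klEngGeo10_CF : klEngGeo9.CF ≤ klEngGeo10.CF := GeoConsts.CF_le_raiseCF klE5CFM_nonneg

/-- `klEngGeo8.CF ≤ klEngGeo10.CF`. -/
theorem klEngGeo8_CF_le_klEngGeo10_CF : klEngGeo8.CF ≤ klEngGeo10.CF := klEngGeo8_CF_le_klEngGeo9_CF.trans klEngGeo9_CF_le_klEngGeo10_CF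

/-- **`klEngGeo8.CF + klE5CFM ≤ klEngGeo10.CF`** (the class-#6 fit's CF hypothesis at the proposed package). -/
theorem klEngGeo8_CF_add_klE5CFM_le_klEngGeo10_CF : klEngGeo8.CF + klE5CFM ≤ klEngGeo10.CF := by
  rw [klEngGeo10_CF]; linarith [klEngGeo8_CF_le_klEngGeo9_CF]

/-- `klIsoT ^ 4 ≤ klEngGeo10.CF` (rides). -/
theorem klIsoT_pow_four_le_klEngGeo10_CF : klIsoT ^ 4 ≤ klEngGeo10.CF := klIsoT_pow_four_le_klEngGeo9_CF.trans klEngGeo9_CF_le_klEngGeo10_CF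

/-- `0 ≤ klEngGeo10.CF`. -/
theorem klEngGeo10_CF_nonneg : 0 ≤ klEngGeo10.CF := klEngGeo9_CF_nonneg.trans klEngGeo9_CF_le_klEngGeo10_CF

/-- untouched field `cE4` (so `klE4TF`, `klE4T6`, `klE4T` ride). -/
theorem klEngGeo10_cE4 : klEngGeo10.cE4 = klEngGeo9.cE4 := rfl
/-- `klE4TF ≤ klEngGeo10.cE4`. -/
theorem klE4TF_le_klEngGeo10_cE4 : klE4TF ≤ klEngGeo10.cE4 := klE4TF_le_klEngGeo9_cE4
/-- `klE4T6 ≤ klEngGeo10.cE4`. -/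
theorem klE4T6_le_klEngGeo10_cE4 : klE4T6 ≤ klEngGeo10.cE4 := klE4T6_le_klEngGeo9_cE4
/-- `klE4T ≤ klEngGeo10.cE4`. -/
theorem klE4T_le_klEngGeo10_cE4 : klE4T ≤ klEngGeo10.cE4 := klE4T_le_klEngGeo9_cE4
/-- untouched field `phGain`. -/
theorem klEngGeo10_phGain : klEngGeo10.phGain = klEngGeo9.phGain := rfl
/-- untouched field `ppGain`. -/
theorem klEngGeo10_ppGain : klEngGeo10.ppGain = klEngGeo9.ppGain := rfl
/-- untouched field `S`. -/
theorem klEngGeo10_S : klEngGeo10.S = klEngGeo9.S := rfl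
/-- `klS6 j ≤ klEngGeo10.S j` (rides). -/
theorem klS6_le_klEngGeo10_S (j : ℕ) : klS6 j ≤ klEngGeo10.S j := klS6_le_klEngGeo9_S j
/-- untouched field `SL`. -/
theorem klEngGeo10_SL : klEngGeo10.SL = klEngGeo9.SL := rfl
/-- untouched field `Bf`. -/
theorem klEngGeo10_Bf : klEngGeo10.Bf = klEngGeo9.Bf := rfl
/-- untouched field `bhi`. -/
theorem klEngGeo10_bhi : klEngGeo10.bhi = klEngGeo9.bhi := rfl
/-- untouched field `blo`. -/
theorem klEngGeo10_blo : klEngGeo10.blo = klEngGeo9.blo := rfl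
/-- untouched field `aplus`. -/
theorem klEngGeo10_aplus : klEngGeo10.aplus = klEngGeo9.aplus := rfl
/-- untouched field `ζ`. -/
theorem klEngGeo10_ζ : klEngGeo10.ζ = klEngGeo9.ζ := rfl
/-- untouched field `Z`. -/
theorem klEngGeo10_Z : klEngGeo10.Z = klEngGeo9.Z := rfl
/-- untouched field `cloc`. -/
theorem klEngGeo10_cloc : klEngGeo10.cloc = klEngGeo9.cloc := rfl
/-- untouched field `θ`. -/
theorem klEngGeo10_θ : klEngGeo10.θ = klEngGeo9.θ := rfl
/-- untouched field `a`. -/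
theorem klEngGeo10_a : klEngGeo10.a = klEngGeo9.a := rfl
/-- untouched field `atop`. -/
theorem klEngGeo10_atop : klEngGeo10.atop = klEngGeo9.atop := rfl
/-- untouched field `abot`. -/
theorem klEngGeo10_abot : klEngGeo10.abot = klEngGeo9.abot := rfl
/-- `thermalBar` at `klEngGeo9` is below `thermalBar` at `klEngGeo10`. -/
theorem thermalBar_klEngGeo9_le_klEngGeo10 (P : SplitConsts) (U β : ℝ) (n : ℕ) :
    thermalBar klEngGeo9 P U β n ≤ thermalBar klEngGeo10 P U β n :=
  thermalBar_le_raiseCF klE5CFM klE5CFM_nonneg P U β n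

/-- **The class-#6 fit at `klEngGeo10`**: `U ≤ klE5uM P R ⟹ klE5AM + 2·(klE5cM + klE5dM P R·Klam²·U) ≤ klEngGeo10.CF` (`P.WF`, `R.WF2`). -/
theorem klE5M_fit_klEngGeo10 {P : SplitConsts} {R : RenConsts} (hP : P.WF) (hR : R.WF2) {U : ℝ} (hU : U ≤ klE5uM P R) :
    klE5AM + 2 * (klE5cM + klE5dM P R * P.Klam ^ 2 * U) ≤ klEngGeo10.CF :=
  klE5M_fit hP hR klEngGeo8_CF_add_klE5CFM_le_klEngGeo10_CF hU

end Summit.HubbardSuperconductivity.HubbardSuperconductivity.Theorems.EngineV8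

end
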